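import Literature.NumberTheory.LFunctions.DworkRationalityMeromorphy
import Mathlib.NumberTheory.Padics.RingHoms
import Mathlib.FieldTheory.Finite.Basic
import HarnessLib

/-!
# Dwork's lifting of characters: the additive character attached to a Teichmüller lifting

Part of the bottom-up proof of Dwork's rationality theorem
(`Literature/NumberTheory/LFunctions/DworkRationality.lean`), towards the named fact
`Dwork.dworkLifting` of `…/DworkRationalityMeromorphy.lean` (Koblitz, GTM 58, Ch. V §2 and §4),
which `…/DworkRationalityLifting.lean` decomposes into three inputs — Dwork's splitting function
`Θ` with `∏_{e<N} Θ(t^{pᵉ}) = ε^{Tr t mod p}` (`Dwork.dworkSplitting`), the integrality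
`Tr t = ∑_{e<N} t^{pᵉ} ∈ ℤ_p` of traces of Teichmüller points (`Dwork.teichmullerTrace`) and the
Teichmüller lifting `τ : 𝔽̄_p → ℂ_p` (`Dwork.teichmullerLift`). This file carries out the part of
Koblitz's Ch. V §4 (pp. 132–133) that concerns the *character*: taking the data of the three
facts as hypotheses (so that nothing here depends on the facts themselves), it proves for
`𝔽_{qˢ} = Dwork.fixedField k s`, `q = pʳ`:

* `Dwork.toZMod_trace_add` — the trace mod `p`, `a ↦ (∑_{e<rs} τ(a)^{pᵉ}) mod p`, is additive
  (Teichmüller lifts are additive modulo the maximal ideal, and Frobenius is additive in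
  characteristic `p`);
* `Dwork.exists_teich_eq` — every `(qˢ-1)`-th root of unity of `ℂ_p` is the lift of an element of
  `𝔽_{qˢ}` (counting roots of `X^{qˢ} - X`);
* `Dwork.sum_units_teich_pow`, `Dwork.exists_norm_trace_not_lt` — the power sums
  `∑_{u ∈ 𝔽_{qˢ}^×} τ(u)ʲ` (Koblitz, Ch. V §4 Ex. 6) and the resulting non-triviality of the trace
  mod `p` (the weighted power sum `∑_u τ(u)^{qˢ-2} Tr(τ u) = qˢ - 1` is a unit);
* `Dwork.exists_character` — the additive character `ψ(a) = ε^{Tr(τ a) mod p}` of `𝔽_{qˢ}` is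
  non-trivial, satisfies the orthogonality relation `∑ₓ ψ(xu) = 0` (`u ≠ 0`; Koblitz, p. 133) and
  `∏_{e<rs} Θ(τ(a)^{pᵉ}) = ψ(a)` (Koblitz, p. 132: `ε^{Tr a} = Θ(t)Θ(tᵖ)⋯Θ(t^{p^{rs-1}})`).

The series `G` and the assembly `dworkSplitting → teichmullerTrace → teichmullerLift →
dworkLifting` are in `…/DworkRationalityLiftingAssembly.lean`.

## References

* N. Koblitz, *p-adic Numbers, p-adic Analysis, and Zeta-Functions*, 2nd ed., GTM 58 (1984),
  Ch. V §2 (pp. 126–128), §4 (pp. 132–134, Ex. 6). [Koblitz1984]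
-/

open Finset

noncomputable section

universe u

namespace Literature.NumberTheory.LFunctions

namespace Dwork

variable {p : ℕ} [Fact p.Prime]

/-! ### Norm bookkeeping in `ℂ_p` -/

section Norms

/-- A finite sum of elements of norm `< 1` has norm `< 1` (ultrametric inequality). [folklore] -/
theorem norm_sum_lt_one {α : Type*} (s : Finset α) {g : α → ℂ_[p]} (h : ∀ a ∈ s, ‖g a‖ < 1) :
    ‖∑ a ∈ s, g a‖ < 1 := by
  classical
  induction s using Finset.induction_on with
  | empty => rw [sum_empty, norm_zero]; exact one_pos
  | insert a s ha ih =>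
    rw [sum_insert ha]
    exact (IsUltrametricDist.norm_add_le_max _ _).trans_lt
      (max_lt (h a (mem_insert_self a s)) (ih fun b hb => h b (mem_insert_of_mem hb)))

/-- `‖c‖_{ℂ_p} = ‖c‖_{ℤ_p}` along `ℤ_p → ℚ_p → ℂ_p`. [folklore] -/
theorem norm_algebraMap_padicInt (c : ℤ_[p]) :
    ‖algebraMap ℚ_[p] ℂ_[p] (c : ℚ_[p])‖ = ‖c‖ := by
  rw [norm_algebraMap']; rfl

/-- An element of `ℤ_p` of norm `< 1` reduces to `0` mod `p`. [folklore] -/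
theorem toZMod_eq_zero_of_norm_lt_one {c : ℤ_[p]} (h : ‖c‖ < 1) : PadicInt.toZMod c = 0 := by
  rw [← RingHom.mem_ker, PadicInt.ker_toZMod, IsLocalRing.mem_maximalIdeal]
  exact PadicInt.mem_nonunits.mpr h

/-- `‖p^N - 1‖ = 1` in `ℂ_p` for `N ≥ 1`. [folklore] -/
theorem norm_pow_sub_one (N : ℕ) (hN : 0 < N) : ‖((p ^ N - 1 : ℕ) : ℂ_[p])‖ = 1 := by
  have hp : (p : ℂ_[p]) = algebraMap ℚ_[p] ℂ_[p] (p : ℚ_[p]) := (map_natCast _ p).symm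
  have hnp : ‖(p : ℂ_[p]) ^ N‖ < 1 := by
    rw [norm_pow, hp, norm_algebraMap']
    exact pow_lt_one₀ (norm_nonneg _) Padic.norm_p_lt_one hN.ne'
  have h1 : ((p ^ N - 1 : ℕ) : ℂ_[p]) = -1 + (p : ℂ_[p]) ^ N := by
    rw [Nat.cast_sub (Nat.one_le_pow N p (Fact.out : p.Prime).pos), Nat.cast_pow, Nat.cast_one]
    ring
  have hne : ‖(-1 : ℂ_[p])‖ ≠ ‖(p : ℂ_[p]) ^ N‖ := by
    rw [norm_neg, norm_one]
    exact (ne_of_lt hnp).symm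
  rw [h1, IsUltrametricDist.norm_add_eq_max_of_norm_ne_norm hne, norm_neg, norm_one]
  exact max_eq_left hnp.le

end Norms

/-! ### The Teichmüller character of `𝔽_{qˢ}` attached to the lifting data -/

section Character

variable {k : Type u} [Field k] [Finite k]

omit [Finite k] in
/-- **Additivity of the trace mod `p`**: if `τ` is additive modulo the maximal ideal and
`cₐ, c_b, c_{a+b} ∈ ℤ_p` are the traces `∑_{e<N} τ(·)^{pᵉ}` of `a`, `b`, `a + b`, then
`c_{a+b} ≡ cₐ + c_b (mod p)` (Koblitz, Ch. V §2, p. 126: the reduction of `Tr_K t` is `Tr a`,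
which is additive). [cite: Koblitz1984, Ch. V §2 p. 126] -/
theorem toZMod_trace_add [CharP k p] {τ : AlgebraicClosure k →*₀ ℂ_[p]}
    (hadd : ∀ x y, ‖τ (x + y) - (τ x + τ y)‖ < 1) (N : ℕ) {a b : AlgebraicClosure k}
    {ca cb cab : ℤ_[p]}
    (ha : (∑ e ∈ range N, τ a ^ p ^ e) = algebraMap ℚ_[p] ℂ_[p] (ca : ℚ_[p]))
    (hb : (∑ e ∈ range N, τ b ^ p ^ e) = algebraMap ℚ_[p] ℂ_[p] (cb : ℚ_[p]))
    (hab : (∑ e ∈ range N, τ (a + b) ^ p ^ e) = algebraMap ℚ_[p] ℂ_[p] (cab : ℚ_[p])) :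
    PadicInt.toZMod cab = PadicInt.toZMod ca + PadicInt.toZMod cb := by
  haveI : CharP (AlgebraicClosure k) p :=
    charP_of_injective_algebraMap (algebraMap k (AlgebraicClosure k)).injective p
  have hdiff : algebraMap ℚ_[p] ℂ_[p] ((cab - ca - cb : ℤ_[p]) : ℚ_[p]) =
      ∑ e ∈ range N, (τ (a ^ p ^ e + b ^ p ^ e) - (τ (a ^ p ^ e) + τ (b ^ p ^ e))) := by
    rw [PadicInt.coe_sub, PadicInt.coe_sub, map_sub, map_sub, ← ha, ← hb, ← hab, ← sum_sub_distrib,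
      ← sum_sub_distrib]
    refine sum_congr rfl fun e _ => ?_
    rw [← map_pow, ← map_pow, ← map_pow, add_pow_char_pow, sub_sub]
  have hlt : ‖cab - ca - cb‖ < 1 := by
    rw [← norm_algebraMap_padicInt, hdiff]
    exact norm_sum_lt_one _ fun e _ => hadd _ _
  have h0 := toZMod_eq_zero_of_norm_lt_one hlt
  rw [map_sub, map_sub, sub_sub, sub_eq_zero] at h0
  exact h0

variable {r : ℕ} (hr : Nat.card k = p ^ r) (s : ℕ) [NeZero s]
include hr

omit [Fact p.Prime] in
/-- `#k = pʳ` forces `r ≥ 1`, so `r s ≥ 1` for `s ≥ 1`. [folklore] -/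
theorem pos_mul_of_card : 0 < r * s := by
  refine Nat.pos_of_ne_zero fun h => ?_
  rcases Nat.mul_eq_zero.mp h with h | h
  · subst h
    rw [pow_zero] at hr
    exact absurd hr (ne_of_gt one_lt_natCard)
  · exact NeZero.ne s h

omit [Fact p.Prime] [Field k] [Finite k] [NeZero s] in
/-- `qˢ = p^{rs}`. [folklore] -/
theorem card_pow_eq : Nat.card k ^ s = p ^ (r * s) := by rw [hr, ← pow_mul]

omit [NeZero s] in
/-- Elements of `𝔽_{qˢ}` satisfy `x^{p^{rs}} = x`, hence so do their Teichmüller lifts.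
[folklore] -/
theorem teich_pow_eq {τ : AlgebraicClosure k →*₀ ℂ_[p]}
    (hfrob : ∀ (N : ℕ) (x : AlgebraicClosure k), x ^ p ^ N = x → τ x ^ p ^ N = τ x)
    (x : fixedField k s) : τ x ^ p ^ (r * s) = τ x :=
  hfrob _ _ (by rw [← card_pow_eq hr s]; exact x.2)

/-- **Every `(qˢ-1)`-th root of unity of `ℂ_p` is a Teichmüller lift** of an element of `𝔽_{qˢ}`
(counting: `τ` is injective on the `qˢ` elements of `𝔽_{qˢ}`, with values among the `≤ qˢ` roots
of `X^{qˢ} - X`). [cite: Koblitz1984, Ch. V §2 p. 126] -/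
theorem exists_teich_eq {τ : AlgebraicClosure k →*₀ ℂ_[p]} (hinj : Function.Injective τ)
    (hfrob : ∀ (N : ℕ) (x : AlgebraicClosure k), x ^ p ^ N = x → τ x ^ p ^ N = τ x)
    {y : ℂ_[p]} (hy : y ^ (Nat.card k ^ s - 1) = 1) : ∃ x : fixedField k s, τ x = y := by
  classical
  set M := Nat.card k ^ s with hM
  have hM0 : M ≠ 0 := pow_ne_zero _ (ne_of_gt (lt_trans zero_lt_one one_lt_natCard))
  have hM1 : 1 < M := Nat.one_lt_pow (NeZero.ne s) one_lt_natCard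
  have hyM : y ^ M = y := by
    rw [← pow_sub_one_mul hM0 y, hy, one_mul]
  let P : Polynomial ℂ_[p] := Polynomial.X ^ M - Polynomial.X
  have hPdeg : P.natDegree = M := by
    rw [Polynomial.natDegree_sub_eq_left_of_natDegree_lt, Polynomial.natDegree_X_pow]
    rw [Polynomial.natDegree_X_pow, Polynomial.natDegree_X]
    exact hM1
  have hP0 : P ≠ 0 := fun h => hM0 (by rw [← hPdeg, h, Polynomial.natDegree_zero])
  have hroot : ∀ z : ℂ_[p], z ^ M = z → z ∈ P.roots.toFinset := fun z hz => by
    rw [Multiset.mem_toFinset, Polynomial.mem_roots hP0, Polynomial.IsRoot.def, Polynomial.eval_sub,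
      Polynomial.eval_pow, Polynomial.eval_X, hz, sub_self]
  let I : Finset ℂ_[p] := (univ : Finset (fixedField k s)).image fun x : fixedField k s => τ x
  have hIsub : I ⊆ P.roots.toFinset := by
    intro z hz
    obtain ⟨x, -, rfl⟩ := mem_image.mp hz
    exact hroot _ (by rw [hM, card_pow_eq hr s]; exact teich_pow_eq hr s hfrob x)
  have hIcard : I.card = M := by
    rw [card_image_of_injective _ (fun a b h => Subtype.ext (hinj h)), card_univ, card_fixedField]
  have hle : P.roots.toFinset.card ≤ I.card :=
    hIcard ▸ (Multiset.toFinset_card_le _).trans (hPdeg ▸ Polynomial.card_roots' P)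
  have hEq : I = P.roots.toFinset := eq_of_subset_of_card_le hIsub hle
  have hyI : y ∈ I := by rw [hEq]; exact hroot y hyM
  obtain ⟨x, -, hx⟩ := mem_image.mp hyI
  exact ⟨x, hx⟩

/-- **Character sums of Teichmüller powers** over `𝔽_{qˢ}^×`: `∑_{u} τ(u)ʲ = qˢ - 1` if
`qˢ - 1 ∣ j` and `0` otherwise (Koblitz, Ch. V §4, Ex. 6, transported along the injective
multiplicative map `τ`). [cite: Koblitz1984, Ch. V §4 Ex. 6] -/
theorem sum_units_teich_pow [Fintype (fixedField k s)ˣ] {τ : AlgebraicClosure k →*₀ ℂ_[p]}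
    (hinj : Function.Injective τ) (j : ℕ) :
    ∑ u : (fixedField k s)ˣ, τ ((u : fixedField k s) : AlgebraicClosure k) ^ j =
      if p ^ (r * s) - 1 ∣ j then ((p ^ (r * s) - 1 : ℕ) : ℂ_[p]) else 0 := by
  classical
  let χ : (fixedField k s)ˣ →* ℂ_[p] :=
    { toFun := fun u => τ ((u : fixedField k s) : AlgebraicClosure k) ^ j
      map_one' := by rw [Units.val_one, Subfield.coe_one, map_one, one_pow]
      map_mul' := fun u v => by rw [Units.val_mul, Subfield.coe_mul, map_mul, mul_pow] }
  have hχ : ∀ u, χ u = τ ((u : fixedField k s) : AlgebraicClosure k) ^ j := fun u => rfl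
  have hsum := sum_hom_units χ
  change ∑ u : (fixedField k s)ˣ, χ u = _
  rw [hsum]
  have hcard : Fintype.card (fixedField k s) - 1 = p ^ (r * s) - 1 := by
    rw [card_fixedField, card_pow_eq hr s]
  have hiff : χ = 1 ↔ p ^ (r * s) - 1 ∣ j := by
    rw [← hcard, ← FiniteField.forall_pow_eq_one_iff]
    constructor
    · intro h1 u
      have hu := DFunLike.congr_fun h1 u
      rw [hχ, MonoidHom.one_apply, ← map_pow, ← map_one τ] at hu
      have hu' := hinj hu
      ext
      rw [Units.val_pow_eq_pow_val, Units.val_one]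
      exact_mod_cast hu'
    · intro h
      ext u
      rw [hχ, MonoidHom.one_apply, ← map_pow, ← SubmonoidClass.coe_pow, ← Units.val_pow_eq_pow_val,
        h u, Units.val_one, Subfield.coe_one, map_one]
  by_cases hdvd : p ^ (r * s) - 1 ∣ j
  · rw [if_pos (hiff.mpr hdvd), if_pos hdvd, ← Nat.card_eq_fintype_card, Nat.card_units,
      Nat.card_eq_fintype_card, hcard]
  · rw [if_neg (fun h => hdvd (hiff.mp h)), if_neg hdvd, Nat.cast_zero]

/-- **Non-triviality of the trace**: some element of `𝔽_{qˢ}` has a Teichmüller lift whose trace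
`∑_{e<rs} τ(x)^{pᵉ}` is a `p`-adic unit (otherwise the weighted power sum
`∑_{u ∈ 𝔽_{qˢ}^×} τ(u)^{qˢ-2} Tr(τ u) = qˢ - 1`, a unit, would have norm `< 1`). [folklore] -/
theorem exists_norm_trace_not_lt [Fintype (fixedField k s)ˣ] {τ : AlgebraicClosure k →*₀ ℂ_[p]}
    (hinj : Function.Injective τ) (hle : ∀ x, ‖τ x‖ ≤ 1) :
    ∃ x : fixedField k s, ¬ ‖∑ e ∈ range (r * s), τ x ^ p ^ e‖ < 1 := by
  classical
  by_contra hall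
  push Not at hall
  set N := r * s with hN
  have hN0 : 0 < N := pos_mul_of_card hr s
  have hp := (Fact.out : p.Prime)
  -- the weighted power sum equals `p^N - 1`
  have hS : ∑ u : (fixedField k s)ˣ, τ ((u : fixedField k s) : AlgebraicClosure k) ^ (p ^ N - 2) *
      ∑ e ∈ range N, τ ((u : fixedField k s) : AlgebraicClosure k) ^ p ^ e =
        ((p ^ N - 1 : ℕ) : ℂ_[p]) := by
    simp_rw [mul_sum, ← pow_add]
    rw [sum_comm]
    simp_rw [sum_units_teich_pow hr s hinj]
    rw [sum_eq_single 0]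
    · rw [pow_zero, ← hN, if_pos]
      have h2 : 2 ≤ p ^ N := le_trans hp.two_le (Nat.le_self_pow hN0.ne' p)
      exact ⟨1, by omega⟩
    · intro e he he0
      rw [← hN, if_neg]
      intro hdvd
      have h2 : 2 ≤ p ^ N := le_trans hp.two_le (Nat.le_self_pow hN0.ne' p)
      have he1 : 1 ≤ p ^ e := Nat.one_le_pow e p hp.pos
      have heq : p ^ N - 2 + p ^ e = (p ^ N - 1) + (p ^ e - 1) := by omega
      rw [heq, Nat.dvd_add_right (dvd_refl _)] at hdvd
      have hlt : p ^ e < p ^ N := Nat.pow_lt_pow_right hp.one_lt (mem_range.mp he)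
      have hpos : 0 < p ^ e - 1 := by
        have : 1 < p ^ e := Nat.one_lt_pow he0 hp.one_lt
        omega
      have := Nat.le_of_dvd hpos hdvd
      omega
    · intro h; exact absurd (mem_range.mpr hN0) h
  -- but every term has norm `< 1`
  have hlt : ‖∑ u : (fixedField k s)ˣ, τ ((u : fixedField k s) : AlgebraicClosure k) ^ (p ^ N - 2) *
      ∑ e ∈ range N, τ ((u : fixedField k s) : AlgebraicClosure k) ^ p ^ e‖ < 1 := by
    refine norm_sum_lt_one _ fun u _ => ?_
    rw [norm_mul, norm_pow]
    calc ‖τ ((u : fixedField k s) : AlgebraicClosure k)‖ ^ (p ^ N - 2) *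
          ‖∑ e ∈ range N, τ ((u : fixedField k s) : AlgebraicClosure k) ^ p ^ e‖
        ≤ 1 * ‖∑ e ∈ range N, τ ((u : fixedField k s) : AlgebraicClosure k) ^ p ^ e‖ :=
          mul_le_mul_of_nonneg_right (pow_le_one₀ (norm_nonneg _) (hle _)) (norm_nonneg _)
      _ < 1 := by rw [one_mul]; exact hall _
  rw [hS, norm_pow_sub_one N hN0] at hlt
  exact lt_irrefl _ hlt

/-- **The additive character `a ↦ ε^{Tr a}` of `𝔽_{qˢ}` and Dwork's splitting at Teichmüller
points** (Koblitz, Ch. V §2, p. 128 and §4, pp. 132–133): given the splitting function `Θ, ε`,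
the integrality of traces and a Teichmüller lifting `τ`, the map
`ψ(a) = ε^{(∑_{e<rs} τ(a)^{pᵉ}) mod p}` is a non-trivial additive character of `𝔽_{qˢ}`, hence
satisfies `∑ₓ ψ(xu) = 0` for `u ≠ 0` (p. 133), and `∏_{e<rs} Θ(τ(a)^{pᵉ}) = ψ(a)`.
[cite: Koblitz1984, Ch. V §2 p. 128, §4 pp. 132–133] -/
theorem exists_character [CharP k p] {Θ : PowerSeries ℂ_[p]} {ε : ℂ_[p]} (hε : IsPrimitiveRoot ε p)
    (hsplit : ∀ (N : ℕ), 0 < N → ∀ (t : ℂ_[p]), t ^ p ^ N = t → ∀ (c : ℤ_[p]),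
        (∑ e ∈ range N, t ^ p ^ e) = algebraMap ℚ_[p] ℂ_[p] (c : ℚ_[p]) →
          ∏ e ∈ range N, evalAt p Θ (fun _ : Unit => t ^ p ^ e) = ε ^ (PadicInt.toZMod c).val)
    (htrace : ∀ (N : ℕ), 0 < N → ∀ (t : ℂ_[p]), t ^ p ^ N = t →
        ∃ c : ℤ_[p], (∑ e ∈ range N, t ^ p ^ e) = algebraMap ℚ_[p] ℂ_[p] (c : ℚ_[p]))
    {τ : AlgebraicClosure k →*₀ ℂ_[p]} (hinj : Function.Injective τ) (hle : ∀ x, ‖τ x‖ ≤ 1)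
    (hadd : ∀ x y, ‖τ (x + y) - (τ x + τ y)‖ < 1)
    (hfrob : ∀ (N : ℕ) (x : AlgebraicClosure k), x ^ p ^ N = x → τ x ^ p ^ N = τ x) :
    ∃ ψ : AddChar (fixedField k s) ℂ_[p],
      (∀ u : fixedField k s, u ≠ 0 → ∑ x : fixedField k s, ψ (x * u) = 0) ∧
        ∀ b : fixedField k s,
          ∏ e ∈ range (r * s), evalAt p Θ (fun _ : Unit => τ b ^ p ^ e) = ψ b := by
  classical
  have hN0 : 0 < r * s := pos_mul_of_card hr s
  have hpow : ∀ x : fixedField k s, τ x ^ p ^ (r * s) = τ x := teich_pow_eq hr s hfrob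
  choose c hc using fun x : fixedField k s => htrace (r * s) hN0 (τ x) (hpow x)
  -- the trace mod `p`, an additive map `𝔽_{qˢ} → 𝔽_p`
  let L : fixedField k s →+ ZMod p := AddMonoidHom.mk' (fun x => PadicInt.toZMod (c x))
    fun x y => by
      have h := hc (x + y)
      rw [Subfield.coe_add] at h
      exact toZMod_trace_add hadd (r * s) (hc x) (hc y) h
  haveI : NeZero p := ⟨(Fact.out : p.Prime).ne_zero⟩
  let ψ : AddChar (fixedField k s) ℂ_[p] := (AddChar.zmodChar p hε.pow_eq_one).compAddMonoidHom L
  have hψ : ∀ b, ψ b = ε ^ (PadicInt.toZMod (c b)).val := fun b => by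
    rw [AddChar.compAddMonoidHom_apply, AddChar.zmodChar_apply]; rfl
  -- `ψ` is non-trivial
  have hψ1 : ψ ≠ 1 := by
    obtain ⟨x, hx⟩ := exists_norm_trace_not_lt hr s hinj hle
    intro h1
    have hcx : ¬ ‖c x‖ < 1 := by rwa [← norm_algebraMap_padicInt, ← hc x]
    have hne : PadicInt.toZMod (c x) ≠ 0 := by
      intro h0
      rw [← RingHom.mem_ker, PadicInt.ker_toZMod, IsLocalRing.mem_maximalIdeal,
        PadicInt.mem_nonunits] at h0
      exact hcx h0
    have hx1 := DFunLike.congr_fun h1 x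
    rw [hψ, AddChar.one_apply] at hx1
    exact hε.pow_ne_one_of_pos_of_lt (ZMod.val_pos.mpr hne).ne' (ZMod.val_lt _) hx1
  refine ⟨ψ, fun u hu => ?_, fun b => ?_⟩
  · rw [show ∑ x, ψ (x * u) = ∑ x, ψ x from
      Fintype.sum_equiv (Equiv.mulRight₀ u hu) _ _ fun x => rfl]
    exact AddChar.sum_eq_zero_of_ne_one hψ1
  · rw [hψ b]
    exact hsplit (r * s) hN0 (τ b) (hpow b) (c b) (hc b)

end Character

end Dwork

end Literature.NumberTheory.LFunctions
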